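import Mathlib
import Summits.CriticalPhenomena.CardyFormulaZ2.Theorems.CardyWhiteToColouredDriftBoundPlackettDefs
import Summits.CriticalPhenomena.CardyFormulaZ2.Theorems.CardyWhiteToColouredDriftBoundStubRegLimit
import Literature.Probability.Percolation.KSTPeriodicDefs
import Literature.Probability.Percolation.Crossings
import Literature.Probability.Percolation.Percolation

/-!
# Plackett/Piterbarg drift of the noise heat flow: locality of rectangle crossings and the
# regularised flow as a pair-law probability

Helper file for crux item `DriftBound` (stmt-CriticalPhenomena-4596, decl
`Summit.CriticalPhenomena.CardyFormulaZ2.Theses.CardyWhiteToColoured.DriftBound`) of route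
`CardyWhiteToColoured` (`CardyFormulaZ2`), line `registered` (`Cruxes/DriftBound/Lines/birth.lean`,
skeleton v4.1, lead c3), sub-goal `pl_regFlow_eq_pairLaw` of the self-dual certificate:

* (i) **locality of rectangle crossings** — the open left–right crossing `lrRect a b c d` of the
  lattice rectangle `[a, b] × [c, d]` only depends on the states of the edges with both end-points
  in the rectangle: the restricted connection `{x ↔ y in S}` is reachability in the open graph
  induced on `S`, whose adjacency only reads the pairs `s(u, v)` with `u, v ∈ S`
  (`rp_induce_openGraph_eq`);
* (ii) **the regularised flow is a pair-law probability** — for a finite set `I` of lattice edges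
  and a measurable event `A` of bond configurations depending only on the edges of `I`,
  `regFlow I A η σ = M(A)`, where `M` is the law of the configuration
  `{e ∈ E(ℤ²) | X̃_e(ξ) + η ζ_e > 0}` of the variance-normalised smoothed field
  `X̃_e(ξ) = normNoise σ ξ (m e)` plus an independent edge noise `η ζ`, under the PAIR law
  `latticeWhiteNoise ⊗ latticeWhiteNoise` of `(ξ, ζ)` (noise on every edge of `ℤ²`, not only on
  `I`). Proof: `M(A) = ∫ P_ζ(section) dP_ξ` (`Measure.map_apply`, `Measure.prod_apply`); by
  `I`-locality of `A` the `ξ`-section is the pull-back, under the restriction of `ζ` to the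
  coordinates `I`, of the event defining `regIndicator I A η (X̃ ξ)` (`rp_section_eq`); and the
  restriction pushes `latticeWhiteNoise = ⨂_e N(0,1)` forward to the finite product
  `⨂_{i ∈ I} N(0,1)` (`rp_map_restrict_eq_pi`, boxes are cylinders: `Measure.pi_eq`,
  `Measure.infinitePi_pi`).

References: G. Grimmett, *Percolation* (2nd ed., Springer 1999), §1.6 and §11.3 (crossings of
boxes; events depending on finitely many edges); D. Beliaev, S. Muirhead, A. Rivera, Ann. Probab.
48 (2020), §2.2 (regularisation of indicators by an independent noise).
-/

noncomputable section

namespace Summit.CriticalPhenomena.CardyFormulaZ2.Cruxes.DriftBound.Birth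

open Set MeasureTheory ProbabilityTheory
open Literature.Probability.LatticeModels Literature.Probability.Percolation

/-! ### (i) Locality of restricted connections and of rectangle crossings -/

/-- Two configurations agreeing on the pairs with both ends in `S` induce the same open graph on
`S`. -/
theorem rp_induce_openGraph_eq {V : Type*} {S : Set V} {ω ω' : BondConfig V}
    (h : ∀ e : Sym2 V, (∀ v ∈ e, v ∈ S) → (e ∈ ω ↔ e ∈ ω')) :
    (openGraph ω).induce S = (openGraph ω').induce S := by
  ext u v
  simp only [SimpleGraph.induce_adj, openGraph_adj]
  have hm : ∀ w ∈ s((u : V), (v : V)), w ∈ S := by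
    intro w hw
    rcases Sym2.mem_iff.1 hw with rfl | rfl
    exacts [u.2, v.2]
  rw [h _ hm]

/-- **Locality of `{x ↔ y in S}`**: it only depends on the states of the pairs with both ends in
`S`. -/
theorem rp_mem_openConnIn_iff {V : Type*} {S : Set V} {ω ω' : BondConfig V}
    (h : ∀ e : Sym2 V, (∀ v ∈ e, v ∈ S) → (e ∈ ω ↔ e ∈ ω')) (x y : V) :
    ω ∈ openConnIn S x y ↔ ω' ∈ openConnIn S x y := by
  simp only [openConnIn, mem_setOf_eq, rp_induce_openGraph_eq h]

/-- **Locality of open crossings**: `openCrossing S A B` only depends on the states of the pairs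
with both ends in `S`. -/
theorem rp_mem_openCrossing_iff {V : Type*} {S A B : Set V} {ω ω' : BondConfig V}
    (h : ∀ e : Sym2 V, (∀ v ∈ e, v ∈ S) → (e ∈ ω ↔ e ∈ ω')) :
    ω ∈ openCrossing S A B ↔ ω' ∈ openCrossing S A B := by
  simp only [mem_openCrossing_iff, rp_mem_openConnIn_iff h]

/-- **Locality of rectangle crossings**: the left–right crossing of `[a, b] × [c, d]` only depends
on the edges with both end-points in the rectangle. -/
theorem rp_mem_lrRect_iff (a b c d : ℤ) {ω ω' : Set (Sym2 (Site 2))}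
    (h : ∀ e : Sym2 (Site 2), (∀ v ∈ e, v ∈ KSTPeriodic.rect a b c d) → (e ∈ ω ↔ e ∈ ω')) :
    ω ∈ KSTPeriodic.lrRect a b c d ↔ ω' ∈ KSTPeriodic.lrRect a b c d :=
  rp_mem_openCrossing_iff h

/-! ### (ii) The regularised flow as a probability under the pair law -/

/-- **Restriction to finitely many coordinates.** For a finite set `I` of lattice edges, the
restriction `ζ ↦ (ζ_i)_{i ∈ I}` pushes the lattice white noise `⨂_{e ∈ E(ℤ²)} N(0,1)` forward to
the finite product `⨂_{i ∈ I} N(0,1)` (the two measures agree on boxes, which pull back to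
cylinders: `Measure.pi_eq`, `Measure.infinitePi_pi`). -/
theorem rp_map_restrict_eq_pi (I : Finset (Sym2 (Site 2)))
    (hIE : (↑I : Set (Sym2 (Site 2))) ⊆ (zdGraph 2).edgeSet) :
    latticeWhiteNoise.map (fun (ζ : (zdGraph 2).edgeSet → ℝ) (i : I) => ζ ⟨i.1, hIE i.2⟩) =
      Measure.pi fun _ : I => gaussianReal 0 1 := by
  classical
  symm
  refine Measure.pi_eq fun s hs => ?_
  have hres : Measurable fun (ζ : (zdGraph 2).edgeSet → ℝ) (i : I) => ζ ⟨i.1, hIE i.2⟩ :=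
    measurable_pi_lambda _ fun i => measurable_pi_apply _
  rw [Measure.map_apply hres (MeasurableSet.univ_pi hs)]
  -- the coordinates of `I` as a finset of edges of `ℤ²`
  let emb : (I : Type) ↪ (zdGraph 2).edgeSet :=
    ⟨fun i => ⟨i.1, hIE i.2⟩, fun i j hij => Subtype.ext (by simpa using congrArg Subtype.val hij)⟩
  let J : Finset (zdGraph 2).edgeSet := Finset.univ.map emb
  let t : (zdGraph 2).edgeSet → Set ℝ := fun e => if h : e.1 ∈ I then s ⟨e.1, h⟩ else univ
  have ht : ∀ i : I, t (emb i) = s i := fun i => by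
    simp only [t, emb, Function.Embedding.coeFn_mk, dif_pos i.2]
  have hpre : (fun (ζ : (zdGraph 2).edgeSet → ℝ) (i : I) => ζ ⟨i.1, hIE i.2⟩) ⁻¹' Set.pi univ s =
      Set.pi ↑J t := by
    ext ζ
    simp only [mem_preimage, mem_univ_pi]
    constructor
    · rintro hζ e he
      obtain ⟨i, -, rfl⟩ := Finset.mem_map.1 (Finset.mem_coe.1 he)
      rw [ht]
      exact hζ i
    · intro hζ i
      rw [← ht]
      exact hζ (emb i) (Finset.mem_coe.2 (Finset.mem_map_of_mem emb (Finset.mem_univ i)))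
  rw [hpre, latticeWhiteNoise, Measure.infinitePi_pi _ (fun e _ => ?_)]
  · rw [Finset.prod_map]
    exact Finset.prod_congr rfl fun i _ => by rw [ht]
  · simp only [t]
    split_ifs with h
    exacts [hs _, MeasurableSet.univ]

/-- **The configuration map of the pair law is measurable**: each coordinate event
`{(ξ, ζ) | X̃_e(ξ) + η ζ_e > 0}` is measurable (`rl_measurable_normNoise`). -/
theorem rp_measurable_cfg (σ η : ℝ) :
    Measurable fun p : ((zdGraph 2).edgeSet → ℝ) × ((zdGraph 2).edgeSet → ℝ) =>
      {e : Sym2 (Site 2) | ∃ h : e ∈ (zdGraph 2).edgeSet,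
        0 < normNoise σ p.1 (medialPoint 1 e) + η * p.2 ⟨e, h⟩} := by
  refine measurable_set_iff.2 fun e => ?_
  by_cases he : e ∈ (zdGraph 2).edgeSet
  · have hm : Measurable fun p : ((zdGraph 2).edgeSet → ℝ) × ((zdGraph 2).edgeSet → ℝ) =>
        normNoise σ p.1 (medialPoint 1 e) + η * p.2 ⟨e, he⟩ :=
      ((rl_measurable_normNoise σ _).comp measurable_fst).add
        (measurable_const.mul ((measurable_pi_apply _).comp measurable_snd))
    have hfun : (fun p : ((zdGraph 2).edgeSet → ℝ) × ((zdGraph 2).edgeSet → ℝ) =>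
        e ∈ {e : Sym2 (Site 2) | ∃ h : e ∈ (zdGraph 2).edgeSet,
          0 < normNoise σ p.1 (medialPoint 1 e) + η * p.2 ⟨e, h⟩}) =
        fun p => 0 < normNoise σ p.1 (medialPoint 1 e) + η * p.2 ⟨e, he⟩ := by
      ext p
      exact ⟨fun ⟨_, hp⟩ => hp, fun hp => ⟨he, hp⟩⟩
    rw [hfun]
    exact measurableSet_setOf.1 (measurableSet_lt measurable_const hm)
  · have hfun : (fun p : ((zdGraph 2).edgeSet → ℝ) × ((zdGraph 2).edgeSet → ℝ) =>
        e ∈ {e : Sym2 (Site 2) | ∃ h : e ∈ (zdGraph 2).edgeSet,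
          0 < normNoise σ p.1 (medialPoint 1 e) + η * p.2 ⟨e, h⟩}) = fun _ => False := by
      ext p
      exact ⟨fun ⟨h, _⟩ => he h, False.elim⟩
    rw [hfun]
    exact measurable_const

/-- **Sections of `I`-local events.** If `A` only depends on the edges of `I ⊆ E(ℤ²)`, then for
every field sample `ξ` the `ξ`-section `{ζ | {e ∈ E(ℤ²) | X̃_e(ξ) + η ζ_e > 0} ∈ A}` of the
pulled-back event is the pull-back, under the restriction of `ζ` to the coordinates `I`, of
`{z ∈ ℝ^I | {e ∈ I | X̃_e(ξ) + η z_e > 0} ∈ A}` (the two configurations have the same trace on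
`I`). -/
theorem rp_section_eq {σ η : ℝ} (I : Finset (Sym2 (Site 2))) {A : Set (Set (Sym2 (Site 2)))}
    (hIE : (↑I : Set (Sym2 (Site 2))) ⊆ (zdGraph 2).edgeSet)
    (hloc : ∀ ω ω' : Set (Sym2 (Site 2)), ω ∩ ↑I = ω' ∩ ↑I → (ω ∈ A ↔ ω' ∈ A))
    (ξ : (zdGraph 2).edgeSet → ℝ) :
    Prod.mk ξ ⁻¹' ((fun p : ((zdGraph 2).edgeSet → ℝ) × ((zdGraph 2).edgeSet → ℝ) =>
        {e : Sym2 (Site 2) | ∃ h : e ∈ (zdGraph 2).edgeSet,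
          0 < normNoise σ p.1 (medialPoint 1 e) + η * p.2 ⟨e, h⟩}) ⁻¹' A) =
      (fun (ζ : (zdGraph 2).edgeSet → ℝ) (i : I) => ζ ⟨i.1, hIE i.2⟩) ⁻¹'
        {z : I → ℝ | {e : Sym2 (Site 2) | ∃ h : e ∈ I,
          0 < normNoise σ ξ (medialPoint 1 e) + η * z ⟨e, h⟩} ∈ A} := by
  ext ζ
  simp only [mem_preimage, mem_setOf_eq]
  refine hloc _ _ (Set.ext fun e => ?_)
  simp only [mem_inter_iff, mem_setOf_eq, Finset.mem_coe]
  constructor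
  · rintro ⟨⟨_, hpos⟩, heI⟩
    exact ⟨⟨heI, hpos⟩, heI⟩
  · rintro ⟨⟨_, hpos⟩, heI⟩
    exact ⟨⟨hIE heI, hpos⟩, heI⟩

/-- **The regularised flow is the pair-law probability of an `I`-local measurable event.**
`regFlow I A η σ = (law of {e | X̃_e(ξ) + η ζ_e > 0} under P_ξ ⊗ P_ζ)(A)`: Tonelli over the pair
law (`Measure.prod_apply`), identification of the sections (`rp_section_eq`) and of the law of the
restricted noise (`rp_map_restrict_eq_pi`) with the Gaussian measure defining `regIndicator`, and
`∫ = toReal ∘ ∫⁻` for the `[0, 1]`-valued regularised indicator. -/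
theorem rp_regFlow_eq_map_prod_real {σ η : ℝ} (I : Finset (Sym2 (Site 2)))
    {A : Set (Set (Sym2 (Site 2)))} (hIE : (↑I : Set (Sym2 (Site 2))) ⊆ (zdGraph 2).edgeSet)
    (hA : MeasurableSet A)
    (hloc : ∀ ω ω' : Set (Sym2 (Site 2)), ω ∩ ↑I = ω' ∩ ↑I → (ω ∈ A ↔ ω' ∈ A)) :
    regFlow I A η σ =
      (Measure.map (fun p : ((zdGraph 2).edgeSet → ℝ) × ((zdGraph 2).edgeSet → ℝ) =>
          {e : Sym2 (Site 2) | ∃ h : e ∈ (zdGraph 2).edgeSet,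
            0 < normNoise σ p.1 (medialPoint 1 e) + η * p.2 ⟨e, h⟩})
        (latticeWhiteNoise.prod latticeWhiteNoise)).real A := by
  have hcfg := rp_measurable_cfg σ η
  have hXm : Measurable fun (ξ : (zdGraph 2).edgeSet → ℝ) (i : I) =>
      normNoise σ ξ (medialPoint 1 i.1) :=
    measurable_pi_lambda _ fun i => rl_measurable_normNoise σ _
  have hres : Measurable fun (ζ : (zdGraph 2).edgeSet → ℝ) (i : I) => ζ ⟨i.1, hIE i.2⟩ :=
    measurable_pi_lambda _ fun i => measurable_pi_apply _
  have hTm : ∀ ξ : (zdGraph 2).edgeSet → ℝ, MeasurableSet {z : I → ℝ |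
      {e : Sym2 (Site 2) | ∃ h : e ∈ I, 0 < normNoise σ ξ (medialPoint 1 e) + η * z ⟨e, h⟩} ∈ A} :=
    fun ξ => rl_measurableSet_cfg_mem I A
      (fun i (z : I → ℝ) => normNoise σ ξ (medialPoint 1 i.1) + η * z i) fun i => by fun_prop
  -- the pair-law side: Tonelli, sections, restriction
  rw [measureReal_def, Measure.map_apply hcfg hA, Measure.prod_apply (hcfg hA)]
  simp_rw [rp_section_eq I hIE hloc, ← Measure.map_apply hres (hTm _),
    rp_map_restrict_eq_pi I hIE]
  -- the flow side: `∫ = toReal ∘ ∫⁻` for the `[0, 1]`-valued regularised indicator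
  rw [regFlow, integral_eq_lintegral_of_nonneg_ae
    (Filter.Eventually.of_forall fun ξ => (regIndicator_mem_Icc I A η _).1)
    ((rl_measurable_regIndicator I A η).comp hXm).aestronglyMeasurable]
  refine congrArg ENNReal.toReal (lintegral_congr fun ξ => ?_)
  exact ENNReal.ofReal_toReal (measure_ne_top _ _)

/-- **Sub-goal `pl_regFlow_eq_pairLaw` of the self-dual certificate (line `registered`, skeleton
v4.1, crux `DriftBound`).** (i) The left–right crossing `lrRect a b c d` only depends on the edges
with both end-points in the rectangle `[a, b] × [c, d]` (`rp_mem_lrRect_iff`). (ii) For `σ > 0`, a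
finite set `I ⊆ E(ℤ²)` of lattice edges and a measurable event `A` depending only on the edges of
`I`, the regularised flow `regFlow I A η σ` equals `M(A)` for the pair law `M` of the configuration
`{e | normNoise σ ξ (m e) + η ζ_e > 0}` under `latticeWhiteNoise ⊗ latticeWhiteNoise`
(`rp_regFlow_eq_map_prod_real`). -/
theorem pl_regFlow_eq_pairLaw : (∀ (a b c d : ℤ) (ω ω' : Set (Sym2 (Literature.Probability.LatticeModels.Site 2))), (∀ e : Sym2 (Literature.Probability.LatticeModels.Site 2), (∀ v ∈ e, v ∈ Literature.Probability.Percolation.KSTPeriodic.rect a b c d) → (e ∈ ω ↔ e ∈ ω')) → (ω ∈ Literature.Probability.Percolation.KSTPeriodic.lrRect a b c d ↔ ω' ∈ Literature.Probability.Percolation.KSTPeriodic.lrRect a b c d)) ∧ ∀ (σ η : ℝ) (I : Finset (Sym2 (Literature.Probability.LatticeModels.Site 2))) (A : Set (Set (Sym2 (Literature.Probability.LatticeModels.Site 2)))), 0 < σ → (↑I : Set (Sym2 (Literature.Probability.LatticeModels.Site 2))) ⊆ (Literature.Probability.LatticeModels.zdGraph 2).edgeSet → MeasurableSet A → (∀ ω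 ω' : Set (Sym2 (Literature.Probability.LatticeModels.Site 2)), ω ∩ ↑I = ω' ∩ ↑I → (ω ∈ A ↔ ω' ∈ A)) → ∀ M : MeasureTheory.Measure (Set (Sym2 (Literature.Probability.LatticeModels.Site 2))), M = MeasureTheory.Measure.map (fun p : ((Literature.Probability.LatticeModels.zdGraph 2).edgeSet → ℝ) × ((Literature.Probability.LatticeModels.zdGraph 2).edgeSet → ℝ) => {e : Sym2 (Literature.Probability.LatticeModels.Site 2) | ∃ h : e ∈ (Literature.Probability.LatticeModels.zdGraph 2).edgeSet, 0 < Summit.CriticalPhenomena.CardyFormulaZ2.Cruxes.DriftBound.Birth.normNoise σ p.1 (Literature.Probability.LatticeModels.medialPoint 1 e) + η * p.2 ⟨e, h⟩}) (Literature.Probability.Percolation.latticeWhiteNoise.prod Literature.Probability.Percolation.latticeWhiteNoise) → Summit.CriticalPhenomena.CardyFormulaZ2.Cruxes.DriftBound.Birth.regFlow I A η σ = M.real A := by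
  refine ⟨fun a b c d ω ω' h => rp_mem_lrRect_iff a b c d h, ?_⟩
  intro σ η I A _ hIE hA hloc M hM
  subst hM
  exact rp_regFlow_eq_map_prod_real I hIE hA hloc

end Summit.CriticalPhenomena.CardyFormulaZ2.Cruxes.DriftBound.Birth

end
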